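import Mathlib

/-!
# Jaffard's theorem — tools: tails from volume growth (dyadic shells) and the Cauchy–Schwarz contraction trick

Two Mathlib-only lemmas used by `…AllWindowsColdBoxJaffardDecay` (LINE-18 stub K1 `DirKernelDipoleDecay`, item K1-J, crux
`AllWindowsColdBox.BulkMidWindowSU2`, stmt-QuantumFields-24006):
* `tail_sum_le_of_growth` — on an index set with volume growth `#{z : d z y ≤ ρ} ≤ c_S (1+ρ)^D`, for `0 ≤ D < r`,
  `Σ_{z : ρ ≤ d z y} (1 + d z y)^{−r} ≤ c_S 2^D (1 − 2^{D−r})⁻¹ (1+ρ)^{D−r}` (dyadic shells `2^i(1+ρ) ≤ 1 + d < 2^{i+1}(1+ρ)`);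
* `sq_mulVec_le_of_form` — a symmetric real matrix with `0 ≤ vᵀRv ≤ q‖v‖²` is an `ℓ²`-contraction `‖Rv‖₂ ≤ q‖v‖₂`
  (Cauchy–Schwarz for the positive semidefinite form via the discriminant; no spectral theorem).
No definitions; standard axioms.

HONEST LABEL: helper lemmas toward one registered stub of a critic-passed line on the R2ξ″ RECORD-rung crux 24006; no stub, crux, rung
or summit is proved here; the Yang–Mills mass gap is NOT proved by this file.
-/

set_option autoImplicit false

open Finset Matrix

namespace Summit.QuantumFields.YangMills.Theorems.AllWindowsColdBox.Jaffard

variable {ι : Type*} [Fintype ι]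

/-- **Tails from volume growth (dyadic shells).**  If `#{z : d z y ≤ ρ} ≤ c_S (1+ρ)^D` for all `ρ ≥ 0` and `0 ≤ D < r`, then
`Σ_{z : ρ ≤ d z y} (1 + d z y)^{−r} ≤ c_S 2^D (1 − 2^{D−r})⁻¹ (1+ρ)^{D−r}`: on the shell `2^i (1+ρ) ≤ 1 + d < 2^{i+1}(1+ρ)` there are at most
`c_S (2^{i+1}(1+ρ))^D` points, each weighing at most `(2^i(1+ρ))^{−r}`.  (So the tail hypothesis of the theorems below follows from the
volume hypothesis, with a worse constant.) -/
theorem tail_sum_le_of_growth (d : ι → ι → ℝ) {r D cS : ℝ} (hD : 0 ≤ D) (hDr : D < r) (hcS : 0 ≤ cS)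
    (hG1 : ∀ (y : ι) (ρ : ℝ), 0 ≤ ρ → ((Finset.univ.filter (fun z => d z y ≤ ρ)).card : ℝ) ≤ cS * (1 + ρ) ^ D)
    (y : ι) (ρ : ℝ) (hρ : 0 ≤ ρ) :
    ∑ z ∈ Finset.univ.filter (fun z => ρ ≤ d z y), ((1 + d z y) ^ r)⁻¹ ≤
      cS * (2 : ℝ) ^ D * (1 - (2 : ℝ) ^ (D - r))⁻¹ * (1 + ρ) ^ (D - r) := by
  classical
  set X : ℝ := 1 + ρ with hX
  have hX1 : 1 ≤ X := by rw [hX]; linarith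
  have hX0 : 0 < X := by linarith
  set F : Finset ι := Finset.univ.filter (fun z => ρ ≤ d z y) with hF
  -- dyadic index of a point of the tail
  set idx : ι → ℕ := fun z => ⌊Real.logb 2 ((1 + d z y) / X)⌋₊ with hidx
  have hT1 : ∀ z ∈ F, 1 ≤ (1 + d z y) / X := by
    intro z hz
    have := (Finset.mem_filter.1 hz).2
    rw [le_div_iff₀ hX0, one_mul, hX]; linarith
  have hlow : ∀ z ∈ F, (2 : ℝ) ^ (idx z : ℝ) * X ≤ 1 + d z y := by
    intro z hz
    have hT := hT1 z hz
    have hT0 : 0 < (1 + d z y) / X := lt_of_lt_of_le one_pos hT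
    have h1 : ((idx z : ℕ) : ℝ) ≤ Real.logb 2 ((1 + d z y) / X) :=
      Nat.floor_le (Real.logb_nonneg one_lt_two hT)
    have h2 : (2 : ℝ) ^ (idx z : ℝ) ≤ (2 : ℝ) ^ Real.logb 2 ((1 + d z y) / X) :=
      Real.rpow_le_rpow_of_exponent_le one_le_two h1
    rw [Real.rpow_logb two_pos (by norm_num) hT0] at h2
    rwa [← le_div_iff₀ hX0]
  have hupp : ∀ z ∈ F, 1 + d z y < (2 : ℝ) ^ ((idx z : ℝ) + 1) * X := by
    intro z hz
    have hT := hT1 z hz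
    have hT0 : 0 < (1 + d z y) / X := lt_of_lt_of_le one_pos hT
    have h1 : Real.logb 2 ((1 + d z y) / X) < (idx z : ℝ) + 1 := Nat.lt_floor_add_one _
    have h2 : (2 : ℝ) ^ Real.logb 2 ((1 + d z y) / X) < (2 : ℝ) ^ ((idx z : ℝ) + 1) :=
      Real.rpow_lt_rpow_of_exponent_lt one_lt_two h1
    rw [Real.rpow_logb two_pos (by norm_num) hT0] at h2
    rwa [← div_lt_iff₀ hX0]
  -- one shell
  set a : ℝ := (2 : ℝ) ^ (D - r) with ha
  have ha0 : 0 < a := Real.rpow_pos_of_pos two_pos _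
  have ha1 : a < 1 := Real.rpow_lt_one_of_one_lt_of_neg one_lt_two (by linarith)
  have hshell : ∀ i : ℕ, ∑ z ∈ F.filter (fun z => idx z = i), ((1 + d z y) ^ r)⁻¹ ≤
      cS * (2 : ℝ) ^ D * X ^ (D - r) * a ^ i := by
    intro i
    have hr0 : 0 ≤ r := by linarith
    have h2i : 0 < (2 : ℝ) ^ (i : ℝ) * X := mul_pos (Real.rpow_pos_of_pos two_pos _) hX0
    -- each term
    have hterm : ∀ z ∈ F.filter (fun z => idx z = i), ((1 + d z y) ^ r)⁻¹ ≤ (((2 : ℝ) ^ (i : ℝ) * X) ^ r)⁻¹ := by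
      intro z hz
      have hzF : z ∈ F := (Finset.mem_filter.1 hz).1
      have hzi : idx z = i := (Finset.mem_filter.1 hz).2
      have h1 : (2 : ℝ) ^ (i : ℝ) * X ≤ 1 + d z y := by rw [← hzi]; exact hlow z hzF
      exact inv_anti₀ (Real.rpow_pos_of_pos h2i r) (Real.rpow_le_rpow h2i.le h1 hr0)
    -- the count
    have hcount : ((F.filter (fun z => idx z = i)).card : ℝ) ≤ cS * ((2 : ℝ) ^ ((i : ℝ) + 1) * X) ^ D := by
      have hsub : F.filter (fun z => idx z = i) ⊆ Finset.univ.filter (fun z => d z y ≤ (2 : ℝ) ^ ((i : ℝ) + 1) * X - 1) := by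
        intro z hz
        have hzF : z ∈ F := (Finset.mem_filter.1 hz).1
        have hzi : idx z = i := (Finset.mem_filter.1 hz).2
        have h1 : 1 + d z y < (2 : ℝ) ^ ((i : ℝ) + 1) * X := by rw [← hzi]; exact hupp z hzF
        exact Finset.mem_filter.2 ⟨Finset.mem_univ _, by linarith⟩
      have hρ' : 0 ≤ (2 : ℝ) ^ ((i : ℝ) + 1) * X - 1 := by
        have : (1 : ℝ) ≤ (2 : ℝ) ^ ((i : ℝ) + 1) := Real.one_le_rpow one_le_two (by positivity)
        nlinarith
      calc ((F.filter (fun z => idx z = i)).card : ℝ)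
            ≤ ((Finset.univ.filter (fun z => d z y ≤ (2 : ℝ) ^ ((i : ℝ) + 1) * X - 1)).card : ℝ) := by
            exact_mod_cast Finset.card_le_card hsub
        _ ≤ cS * (1 + ((2 : ℝ) ^ ((i : ℝ) + 1) * X - 1)) ^ D := hG1 y _ hρ'
        _ = cS * ((2 : ℝ) ^ ((i : ℝ) + 1) * X) ^ D := by rw [add_sub_cancel]
    -- the rpow algebra: `(2^{i+1} X)^D (2^i X)^{-r} = 2^D X^{D-r} a^i`
    have halg : ((2 : ℝ) ^ ((i : ℝ) + 1) * X) ^ D * (((2 : ℝ) ^ (i : ℝ) * X) ^ r)⁻¹ =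
        (2 : ℝ) ^ D * X ^ (D - r) * a ^ i := by
      have h2 : (0 : ℝ) < 2 := two_pos
      rw [Real.mul_rpow (Real.rpow_nonneg h2.le _) hX0.le, Real.mul_rpow (Real.rpow_nonneg h2.le _) hX0.le,
        ← Real.rpow_mul h2.le, ← Real.rpow_mul h2.le, ha, ← Real.rpow_natCast ((2 : ℝ) ^ (D - r)) i,
        ← Real.rpow_mul h2.le, Real.rpow_sub hX0, mul_inv, ← Real.rpow_neg h2.le, div_eq_mul_inv]
      have e1 : (2 : ℝ) ^ (((i : ℝ) + 1) * D) * (2 : ℝ) ^ (-((i : ℝ) * r)) = (2 : ℝ) ^ D * (2 : ℝ) ^ ((D - r) * (i : ℝ)) := by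
        rw [← Real.rpow_add h2, ← Real.rpow_add h2]; congr 1; ring
      calc (2 : ℝ) ^ (((i : ℝ) + 1) * D) * X ^ D * ((2 : ℝ) ^ (-((i : ℝ) * r)) * (X ^ r)⁻¹)
            = ((2 : ℝ) ^ (((i : ℝ) + 1) * D) * (2 : ℝ) ^ (-((i : ℝ) * r))) * (X ^ D * (X ^ r)⁻¹) := by ring
        _ = (2 : ℝ) ^ D * (2 : ℝ) ^ ((D - r) * (i : ℝ)) * (X ^ D * (X ^ r)⁻¹) := by rw [e1]
        _ = (2 : ℝ) ^ D * (X ^ D * (X ^ r)⁻¹) * (2 : ℝ) ^ ((D - r) * (i : ℝ)) := by ring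
    calc ∑ z ∈ F.filter (fun z => idx z = i), ((1 + d z y) ^ r)⁻¹
          ≤ ∑ z ∈ F.filter (fun z => idx z = i), (((2 : ℝ) ^ (i : ℝ) * X) ^ r)⁻¹ := Finset.sum_le_sum hterm
      _ = ((F.filter (fun z => idx z = i)).card : ℝ) * (((2 : ℝ) ^ (i : ℝ) * X) ^ r)⁻¹ := by
          rw [Finset.sum_const, nsmul_eq_mul]
      _ ≤ cS * ((2 : ℝ) ^ ((i : ℝ) + 1) * X) ^ D * (((2 : ℝ) ^ (i : ℝ) * X) ^ r)⁻¹ :=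
          mul_le_mul_of_nonneg_right hcount (inv_nonneg.2 (Real.rpow_nonneg h2i.le _))
      _ = cS * (2 : ℝ) ^ D * X ^ (D - r) * a ^ i := by rw [mul_assoc cS, halg]; ring
  -- sum over the shells
  have hfib := Finset.sum_fiberwise_of_maps_to (s := F) (t := F.image idx) (g := idx)
    (fun z hz => Finset.mem_image_of_mem idx hz) (fun z => ((1 + d z y) ^ r)⁻¹)
  rw [← hfib]
  have hgeom : ∑ i ∈ F.image idx, a ^ i ≤ (1 - a)⁻¹ := by
    have hs := summable_geometric_of_lt_one ha0.le ha1
    calc ∑ i ∈ F.image idx, a ^ i ≤ ∑' i, a ^ i := hs.sum_le_tsum _ fun i _ => pow_nonneg ha0.le i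
      _ = (1 - a)⁻¹ := tsum_geometric_of_lt_one ha0.le ha1
  have hK0 : 0 ≤ cS * (2 : ℝ) ^ D * X ^ (D - r) :=
    mul_nonneg (mul_nonneg hcS (Real.rpow_nonneg two_pos.le _)) (Real.rpow_nonneg hX0.le _)
  calc ∑ i ∈ F.image idx, ∑ z ∈ F.filter (fun z => idx z = i), ((1 + d z y) ^ r)⁻¹
        ≤ ∑ i ∈ F.image idx, cS * (2 : ℝ) ^ D * X ^ (D - r) * a ^ i := Finset.sum_le_sum fun i _ => hshell i
    _ = cS * (2 : ℝ) ^ D * X ^ (D - r) * ∑ i ∈ F.image idx, a ^ i := by rw [Finset.mul_sum]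
    _ ≤ cS * (2 : ℝ) ^ D * X ^ (D - r) * (1 - a)⁻¹ := mul_le_mul_of_nonneg_left hgeom hK0
    _ = cS * (2 : ℝ) ^ D * (1 - a)⁻¹ * X ^ (D - r) := by ring


/-- **Cauchy–Schwarz trick**: a symmetric matrix with `0 ≤ vᵀRv ≤ q‖v‖²` for all `v` is an `ℓ²`-contraction, `‖Rv‖₂ ≤ q‖v‖₂`
(`‖Rv‖⁴ = ⟨Rv, Rv⟩² = ⟨v, R(Rv)⟩² ≤ ⟨v,Rv⟩⟨Rv,R(Rv)⟩ ≤ q²‖v‖²‖Rv‖²`; no spectral theorem needed). -/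
theorem sq_mulVec_le_of_form {R : Matrix ι ι ℝ} (hsymm : R.IsSymm) {q : ℝ}
    (hpsd : ∀ v : ι → ℝ, 0 ≤ v ⬝ᵥ (R *ᵥ v)) (hform : ∀ v : ι → ℝ, v ⬝ᵥ (R *ᵥ v) ≤ q * ∑ x, v x ^ 2)
    (v : ι → ℝ) : ∑ x, (R *ᵥ v) x ^ 2 ≤ q ^ 2 * ∑ x, v x ^ 2 := by
  -- the bilinear form `B a b = a ⬝ R b` is symmetric
  have hB : ∀ a b : ι → ℝ, a ⬝ᵥ (R *ᵥ b) = b ⬝ᵥ (R *ᵥ a) := by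
    intro a b
    rw [Matrix.dotProduct_mulVec, ← Matrix.mulVec_transpose, hsymm.eq, dotProduct_comm]
  -- Cauchy–Schwarz for `B` via the discriminant
  have hCS : ∀ a b : ι → ℝ, (a ⬝ᵥ (R *ᵥ b)) ^ 2 ≤ (a ⬝ᵥ (R *ᵥ a)) * (b ⬝ᵥ (R *ᵥ b)) := by
    intro a b
    have hquad : ∀ t : ℝ, 0 ≤ (b ⬝ᵥ (R *ᵥ b)) * (t * t) + (2 * (a ⬝ᵥ (R *ᵥ b))) * t + a ⬝ᵥ (R *ᵥ a) := by
      intro t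
      have h := hpsd (a + t • b)
      have hexp : (a + t • b) ⬝ᵥ (R *ᵥ (a + t • b)) =
          (b ⬝ᵥ (R *ᵥ b)) * (t * t) + (2 * (a ⬝ᵥ (R *ᵥ b))) * t + a ⬝ᵥ (R *ᵥ a) := by
        rw [Matrix.mulVec_add, Matrix.mulVec_smul, add_dotProduct, dotProduct_add, dotProduct_add,
          smul_dotProduct, smul_dotProduct, dotProduct_smul, dotProduct_smul, hB b a]
        simp only [smul_eq_mul]
        ring
      rw [hexp] at h
      exact h
    have hd := discrim_le_zero hquad
    rw [discrim] at hd
    nlinarith [hd]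
  set w : ι → ℝ := R *ᵥ v with hw
  have hww : ∑ x, w x ^ 2 = v ⬝ᵥ (R *ᵥ w) := by
    rw [hB v w, hw, dotProduct]
    exact Finset.sum_congr rfl fun x _ => by ring
  have h1 : (∑ x, w x ^ 2) ^ 2 ≤ (q * ∑ x, v x ^ 2) * (q * ∑ x, w x ^ 2) := by
    rw [hww]
    calc (v ⬝ᵥ (R *ᵥ w)) ^ 2 ≤ (v ⬝ᵥ (R *ᵥ v)) * (w ⬝ᵥ (R *ᵥ w)) := hCS v w
      _ ≤ (q * ∑ x, v x ^ 2) * (q * ∑ x, w x ^ 2) :=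
          mul_le_mul (hform v) (hform w) (hpsd w) (by have := hpsd v; have := hform v; linarith)
      _ = (q * ∑ x, v x ^ 2) * (q * v ⬝ᵥ (R *ᵥ w)) := by rw [hww]
  have hs0 : 0 ≤ ∑ x, w x ^ 2 := Finset.sum_nonneg fun x _ => sq_nonneg _
  have hv0 : 0 ≤ ∑ x, v x ^ 2 := Finset.sum_nonneg fun x _ => sq_nonneg _
  by_cases hz : ∑ x, w x ^ 2 = 0
  · rw [hz]; positivity
  · have hpos : 0 < ∑ x, w x ^ 2 := lt_of_le_of_ne hs0 (Ne.symm hz)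
    nlinarith [h1, hpos]

end Summit.QuantumFields.YangMills.Theorems.AllWindowsColdBox.Jaffard
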